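import Literature.NumberTheory.EllipticCurves.Sprung2012.SharpFlatSelmer
import Literature.NumberTheory.EllipticCurves.Kobayashi2003.SignedSelmerRankBoundProofs
import Literature.NumberTheory.EllipticCurves.IwasawaSelmerDualProofs
import HarnessLib

/-!
# Route `ByReductionTypeAtTwo` (rung K4), crux `SupersingularRankZeroAtTwo` (item stmt-BirchSwinnertonDyer-19097), stub 5
# `stub_flatKernelCyclic` (hand h13), sub-hand h13b, brick (K2): **every class of `Sel_{p^∞}(E/K_∞)` — and each of its
# `Γ_K`-conjugates — is, at the place singled out by `closureEmb K_v`, the KUMMER CLASS of a point of `E(K_∞·K_v)`**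
# (`x ⊗ p^{-k}`, `x ∈ localTowerPointsOfEmb`): the classical local condition `localKerOver` IS the Kummer condition over the
# fixed points (tree: `Kobayashi2003.localKerOverOfEmb_le_localKummerOverOfEmb_fixedPoints`, `Gal(K̄/K_∞)` compact), and
# `localTowerPointsOfEmb κ ι W` is that fixed-point subgroup by definition (cell `bsd-2adic`, seat `bsd-2adic-t42` GEN 44;
# `--supports 19097`, helper)

HONEST FRAMING (D-0036/D-0054): THEOREMS ONLY (no definition, no named fact, no `sorry`, no instance); generic number field `K`,
prime `p`, `ℤ_p`-extension `κ`, curve `W`, finite place `v`.  This is the «Selmer class ↦ Kummer representative» step of the Kummer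
injection `Sel_∞ ⧸ Sel♭ ↪ Λ^∨` (memo `t42/gen44/FLAT-KERNEL-CYCLIC-GEN44.md` §2, (K2)); independence of the representative, equivariance
and the `⨅_σ` collapse are NOT here.  19097 OPEN; BSD proved for no curve.

References: [Kobayashi2003] Def. 1.1, §2 p. 4 («we regard `E(K_{n,v}) ⊗ ℚ_p/ℤ_p` as a subgroup of `H¹(K_{n,v}, E[p^∞])` by the Kummer map»);
[GreenbergLNM1716] §2; [Sprung2012] Lemma 7.10, Def. 7.11.
-/

set_option autoImplicit false
-- the Theorems namespace of this sub repeats the summit name by design (D-0017 nested layout)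
set_option linter.dupNamespace false

noncomputable section

open scoped Classical

universe u

namespace Summit.BirchSwinnertonDyer.BirchSwinnertonDyer.Theorems

namespace OddBlindNF

open NumberField IsDedekindDomain WeierstrassCurve Literature.NumberTheory.EllipticCurves
  Literature.NumberTheory.EllipticCurves.Sprung2012 Literature.NumberTheory.EllipticCurves.Sprung2017
  Literature.NumberTheory.EllipticCurves.Kobayashi2003 Literature.NumberTheory.GaloisRepresentations ZpExtension

variable {K : Type u} [Field K] [NumberField K] (W : WeierstrassCurve K) {p : ℕ} [Fact p.Prime] (κ : ZpExtension K p)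

/-- **Every conjugate of a Selmer class is a Kummer class of a tower point at `closureEmb K_v`.**  For `s ∈ Sel_{p^∞}(E/K_∞)`,
a finite place `v` and `σ ∈ Γ_K`: `conj_σ s` lies in `localKummerOverOfEmb W p (ker κ) (closureEmb K_v) (E(K_∞·K_v))`, i.e. its
restriction to `Gal(K̄_v/K_∞·K_v)` is the Kummer cocycle `τ ↦ τQ − Q` of some `Q` with `p^k Q ∈ E(K_∞·K_v)` — the class of
`p^kQ ⊗ p^{-k}`.  KERNEL: the Selmer local condition at `v` (`mem_selmerGroupOver_iff`, `localKerOver_eq_ofEmb`) and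
`localKerOverOfEmb_le_localKummerOverOfEmb_fixedPoints` (`Gal(K̄/K_∞)` compact). [cite: Kobayashi2003, Def. 1.1 and §2 p. 4]
[cite: GreenbergLNM1716, §2] -/
theorem conjH1_mem_localKummerOverOfEmb_localTowerPoints (v : HeightOneSpectrum (𝓞 K)) (σ : Field.absoluteGaloisGroup K)
    {s : W.subgroupH1 p κ.kerSubgroup} (hs : s ∈ W.selmerInfty κ) :
    W.conjH1 p κ.kerSubgroup σ s ∈
      localKummerOverOfEmb W p κ.kerSubgroup (closureEmb (K := K) (v.adicCompletion K))
        (localTowerPointsOfEmb κ (closureEmb (K := K) (v.adicCompletion K)) W) := by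
  have hloc : W.conjH1 p κ.kerSubgroup σ s ∈ W.localKerOver p κ.kerSubgroup (v.adicCompletion K) :=
    ((W.mem_selmerGroupOver_iff p κ.kerSubgroup s).mp hs).1 v σ
  rw [localKerOver_eq_ofEmb] at hloc
  exact localKerOverOfEmb_le_localKummerOverOfEmb_fixedPoints W p κ.kerSubgroup _ hloc

/-- **Explicit Kummer representative** (unfolding of the previous lemma): for `s ∈ Sel_∞`, `v`, `σ`, there are a cocycle `φ`
representing `conj_σ s`, a point `Q ∈ E(K̄_v)` and `k ≥ 0` with `p^k Q ∈ E(K_∞·K_v)` such that `φ` restricted to `Gal(K̄_v/K_∞·K_v)`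
is `τ ↦ τQ − Q`. [cite: Kobayashi2003, Def. 1.1 and §2 p. 4] [cite: Sprung2012, Lemma 7.10 (p. 1503)] -/
theorem exists_kummerRepresentative_conjH1 (v : HeightOneSpectrum (𝓞 K)) (σ : Field.absoluteGaloisGroup K)
    {s : W.subgroupH1 p κ.kerSubgroup} (hs : s ∈ W.selmerInfty κ) :
    ∃ (φ : contOneCocycles.{0, u} (discreteTopRep κ.kerSubgroup (W.geomPrimaryTorsion p)))
      (Q : localPoints W (v.adicCompletion K)) (k : ℕ),
      oneCocycleClass (discreteTopRep κ.kerSubgroup (W.geomPrimaryTorsion p)) φ = W.conjH1 p κ.kerSubgroup σ s ∧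
      (p ^ k) • Q ∈ localTowerPointsOfEmb κ (closureEmb (K := K) (v.adicCompletion K)) W ∧
      ∀ τ : localSubgroupOfEmb κ.kerSubgroup (closureEmb (K := K) (v.adicCompletion K)),
        pointsMapOfEmb W (closureEmb (K := K) (v.adicCompletion K))
            ((φ.1 (resGalSubgroupOfEmb κ.kerSubgroup (closureEmb (K := K) (v.adicCompletion K)) τ) :
              W.geomPrimaryTorsion p) : W.geomPoints) =
          (τ : Field.absoluteGaloisGroup (v.adicCompletion K)) • Q - Q := by
  obtain ⟨φ, Q, k, hφ, hQ, hτ⟩ := conjH1_mem_localKummerOverOfEmb_localTowerPoints W κ v σ hs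
  exact ⟨φ, Q, k, hφ, hQ, hτ⟩

end OddBlindNF

end Summit.BirchSwinnertonDyer.BirchSwinnertonDyer.Theorems

end
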